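import Summits.BirchSwinnertonDyer.BirchSwinnertonDyer.Theorems.EisensteinPrimesBSDpOnCellCTelescopeK2BigRepUnramified
import HarnessLib

/-!
# Crux 4 `BSDpOnCellC` (stmt-BirchSwinnertonDyer-19034), line «telescope» v9, leaf N2 `stub_weightTwoControl`,
# sub-leaf W3 input (I-fg): the dual Selmer module of the TORSION subrepresentation `(A ⊗ Λ_𝒪^*)[c]` is a
# finitely generated `Λ_𝒪`-module (helper; closes nothing)

Route `EisensteinPrimes`, crux `BSDpOnCellC`; ideator seat `bsd-idea-12` (gen 37), `--supports
stmt-BirchSwinnertonDyer-19034 --as helper`. THEOREMS only; no `def`, no instance, no named fact, no `sorry`.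
HONEST FRAMING: bookkeeping over binders; proves no crux, no registered stub, no summit statement; BSD is proved
for no curve here.

WHAT AND WHY. The LEAD's transport core `TelescopeK2WeightTwoTransportCore.isTorsion_and_charIdeal_le_of_quasiIso`
(cruxlead-19034 g3, helper #5) reduces sub-leaf W3 of `stub_weightTwoControl` to an `E`-side input (I-E) and to
(I-fg) `Module.Finite _ (CharacterModule (TorsionControl.selmer (localMap K) (strictSet p 𝔮 ∅)
(TorsionControl.torsionRep (AnticyclotomicBigGaloisRep κ ρ) (PowerSeries.C c))))`.  This file supplies the
`Λ_𝒪 = PowerSeries 𝒪`-module half of (I-fg) for ANY `c : Λ_𝒪`, by name, from the same two inputs as conjunct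
(fg) (`TelescopeK2BigRepUnramified.module_finite_XBig_of_isUnramifiedOutside`, p748872): the cofinite generation
`hD` of the big module `M = A ⊗ Λ_𝒪^*` and unramifiedness of `ρ` outside a finite set —

* §1 `ker ρ ≤ ker ρ[c]` for the torsion subrepresentation `TorsionControl.torsionRep ρ c` on `M[c]`;
* §2 `M[c]` is cofinitely generated (`IsCofinitelyGenerated.submodule`), unramified wherever `M` is, so
  Greenberg 2006 Prop. 3.2 in the form `TelescopeK2SelmerCofinite.module_finite_characterModule_selmer` (p748332)
  gives `Module.Finite Λ_𝒪 (Sel_{strict}(K, M[c]))^∨` (`module_finite_characterModule_selmer_torsionRep`, and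
  `…_of_isUnramifiedOutside` with the finite `S` produced by `exists_finite_ramificationSubgroup_le_ker`);
* §3 the K2 instance `B = ℤ_p⟦X⟧⟦T⟧ ≃+* ℤ_p⟦T₁,T₂⟧` (`nonempty_iwasawaAlgebraTwoVar_ringEquiv_mvPowerSeries`),
  `Σ = ∅`, hypotheses `hD`, `hur` of telescope v9 `stub_weightTwoControl` / of
  `module_finite_XBig_twoVar_of_isUnramifiedOutside` token for token
  (`module_finite_characterModule_selmer_torsionRep_twoVar_of_isUnramifiedOutside`); `hD` itself is
  `TelescopeK2FibreCofinite.isCofinitelyGenerated_bigRepModule_twoVar_of_fd_primaryTorsion` (ideator helper #9)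
  from the leaf's (tor) + (fd₀).

What is NOT done here: the passage from `Module.Finite B Y` to `Module.Finite Λ Y` for the LEAD's scalar tower
`[Module Λ Y] [IsScalarTower Λ B Y]` (`Λ = ℤ_p⟦T⟧`; a finite change of rings `B/(C c) → Λ`-structure at `c = C X`),
and the `E`-side input (I-E).

References: [Greenberg2006] Prop. 3.2 (p. 358 L37: "`H¹(K_Σ/K, 𝒟)` is a cofinitely generated `Λ`-module" for
every cofinitely generated discrete `𝒟`), §3A Prop. 3.1 (submodules); [Castella2018Erratum] §2, Lemma 2.1
(p. 2: the Selmer group `Sel^Σ_𝔭(K, M_g[ϖ^m])` of the torsion submodule); [SkinnerUrban2014] §3.1.3.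

## References
[cite: Greenberg2006, §3 A Prop. 3.1 (p. 358 L16–19) and Prop. 3.2 (p. 358 L37)] [cite: Castella2018Erratum, §2, Lemma 2.1 (p. 2)]
[cite: SkinnerUrban2014, §3.1.3]
-/

set_option linter.dupNamespace false
set_option autoImplicit false

noncomputable section

open Field IsDedekindDomain NumberField Topology
open Literature.NumberTheory.GaloisRepresentations Literature.NumberTheory.EllipticCurves
open Literature.NumberTheory.IwasawaTheory
open Summit.BirchSwinnertonDyer.Rank1Residual.X11b
open scoped NumberField

namespace Summit.BirchSwinnertonDyer.BirchSwinnertonDyer.Theorems.TelescopeK2TorsionSelmerCofinite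

universe u

/-! ## §1. The torsion subrepresentation has the bigger kernel -/

section Kernel

variable {Λ : Type*} [CommRing Λ] [TopologicalSpace Λ]
  {Γ : Type u} [Group Γ] [TopologicalSpace Γ]
  {M : Type u} [AddCommGroup M] [Module Λ M] [TopologicalSpace M]

/-- `ker ρ ≤ ker ρ|_{M[c]}`: an element acting trivially on `M` acts trivially on `M[c]`.
[cite: Castella2018Erratum, Lemma 2.1 (p. 2, "the inclusion `M_g[ϖ^m] ⊂ M_g`")] -/
theorem ker_le_ker_torsionRep (ρ : ContinuousRep Γ Λ M) (c : Λ) :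
    ρ.ker ≤ (TorsionControl.torsionRep ρ c).ker := fun g hg ↦ by
  rw [ContinuousRep.mem_ker] at hg ⊢
  refine LinearMap.ext fun m ↦ Subtype.ext ?_
  rw [TorsionControl.torsionRep_apply_coe, hg, LinearMap.id_apply, LinearMap.id_apply]

end Kernel

/-! ## §2. `Sel_{strict}(K, (A ⊗ Λ_𝒪^*)[c])^∨` is finitely generated over `Λ_𝒪` -/

section K2

variable {K : Type} [Field K] [NumberField K] {p : ℕ} [Fact p.Prime]
  {𝒪 : Type} [CommRing 𝒪] [TopologicalSpace 𝒪] [TopologicalSpace (PowerSeries 𝒪)]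
  {A : Type} [AddCommGroup A] [Module 𝒪 A] [TopologicalSpace A] [DiscreteTopology A]
  [ContinuousSMul (PowerSeries 𝒪) (BigRepModule 𝒪 p A)]

/-- **(I-fg), `Λ_𝒪`-half: `Sel_{strict}(K, M[c])^∨` is a finitely generated `Λ_𝒪 = PowerSeries 𝒪`-module**
for `M = A ⊗ Λ_𝒪^*(Ψ⁻¹)` cofinitely generated over `Λ_𝒪 ≃+* ℤ_p⟦T₁,…,T_m⟧` and unramified outside a finite
`S ⊇ Σ ∪ {w ∣ p}` (`N_S ≤ ker`), and ANY `c : Λ_𝒪` — Greenberg 2006 Prop. 3.2 for the cofinitely generated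
discrete module `M[c]` (p748332 `module_finite_characterModule_selmer`).
[cite: Greenberg2006, §3 A Prop. 3.1 (p. 358 L16–19) and Prop. 3.2 (p. 358 L37)] [cite: Castella2018Erratum, §2, Lemma 2.1 (p. 2)] -/
theorem module_finite_characterModule_selmer_torsionRep {m : ℕ}
    (e : PowerSeries 𝒪 ≃+* MvPowerSeries (Fin m) ℤ_[p])
    (κ : ZpExtension K p) (ρ : ContinuousRep (absoluteGaloisGroup K) 𝒪 A)
    (hD : Greenberg2006.IsCofinitelyGenerated (PowerSeries 𝒪) (BigRepModule 𝒪 p A))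
    (S : Set (HeightOneSpectrum (𝓞 K))) (hSfin : S.Finite)
    (hker : ramificationSubgroup K S ≤ (AnticyclotomicBigGaloisRep κ ρ).ker)
    (𝔮 : HeightOneSpectrum (𝓞 K)) (Sig : Set (HeightOneSpectrum (𝓞 K)))
    (hS : ∀ w, w ∉ S → w ∉ Sig ∧ ((p : ℕ) : 𝓞 K) ∉ w.asIdeal) (c : PowerSeries 𝒪) :
    Module.Finite (PowerSeries 𝒪) (CharacterModule (TorsionControl.selmer (BigGaloisRep.localMap K)
      (BigGaloisRep.strictSet p 𝔮 Sig) (TorsionControl.torsionRep (AnticyclotomicBigGaloisRep κ ρ) c))) :=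
  TelescopeK2SelmerCofinite.module_finite_characterModule_selmer S e
    (hD.submodule (Submodule.torsionBy (PowerSeries 𝒪) (BigRepModule 𝒪 p A) c)) hSfin
    (TorsionControl.torsionRep (AnticyclotomicBigGaloisRep κ ρ) c)
    (hker.trans (ker_le_ker_torsionRep (AnticyclotomicBigGaloisRep κ ρ) c))
    (BigGaloisRep.strictSet p 𝔮 Sig) (TelescopeK2SelmerCofinite.inr_mem_strictSet_of_not_mem 𝔮 Sig S hS)

/-- The same with the finite set `S` PRODUCED from unramifiedness of `ρ` outside a finite `S₀` and a finite `Σ`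
(`TelescopeK2BigRepUnramified.exists_finite_ramificationSubgroup_le_ker`, p748872).
[cite: Greenberg2006, Prop. 3.2 (p. 358 L37)] [cite: Castella2018Erratum, §2, Lemma 2.1 (p. 2)] -/
theorem module_finite_characterModule_selmer_torsionRep_of_isUnramifiedOutside {m : ℕ}
    (e : PowerSeries 𝒪 ≃+* MvPowerSeries (Fin m) ℤ_[p])
    (κ : ZpExtension K p) (ρ : ContinuousRep (absoluteGaloisGroup K) 𝒪 A)
    (hD : Greenberg2006.IsCofinitelyGenerated (PowerSeries 𝒪) (BigRepModule 𝒪 p A))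
    {S₀ : Set (HeightOneSpectrum (𝓞 K))} (hS₀ : S₀.Finite) (h : GaloisRep.IsUnramifiedOutside S₀ ρ)
    (𝔮 : HeightOneSpectrum (𝓞 K)) (Sig : Set (HeightOneSpectrum (𝓞 K))) (hSig : Sig.Finite)
    (c : PowerSeries 𝒪) :
    Module.Finite (PowerSeries 𝒪) (CharacterModule (TorsionControl.selmer (BigGaloisRep.localMap K)
      (BigGaloisRep.strictSet p 𝔮 Sig) (TorsionControl.torsionRep (AnticyclotomicBigGaloisRep κ ρ) c))) := by
  obtain ⟨S, hSfin, hS, -, hker⟩ :=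
    TelescopeK2BigRepUnramified.exists_finite_ramificationSubgroup_le_ker κ ρ hS₀ h Sig hSig
  exact module_finite_characterModule_selmer_torsionRep e κ ρ hD S hSfin hker 𝔮 Sig hS c

end K2

/-! ## §3. The K2 instance `B = ℤ_p⟦X⟧⟦T⟧`, `Σ = ∅` -/

section K2TwoVar

variable {K : Type} [Field K] [NumberField K]

/-- **(I-fg), `B`-half, at the telescope's leaf N2**: for `B = ℤ_p⟦X⟧⟦T⟧`, `Σ = ∅`, and the v9
`stub_weightTwoControl` data `hD` (= ideator helper #9 from (tor) + (fd₀)) and `hur` (= the leaf's (unr)),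
`Sel_{strict}(K, (A₂ ⊗ B^*)[c])^∨` is a finitely generated `B`-module for every `c : B` (at `c = C X`: the
weight-two fibre's Selmer dual `Y` of the LEAD's transport core).
[cite: Greenberg2006, Prop. 3.2 (p. 358 L37)] [cite: Greenberg2016Selmer, §1 p. 4 L11–13] -/
theorem module_finite_characterModule_selmer_torsionRep_twoVar_of_isUnramifiedOutside {p : ℕ} [Fact p.Prime]
    {A₂ : Type} [AddCommGroup A₂] [Module (PowerSeries ℤ_[p]) A₂] [TopologicalSpace A₂] [DiscreteTopology A₂]
    [TopologicalSpace (PowerSeries ℤ_[p])] [TopologicalSpace (PowerSeries (PowerSeries ℤ_[p]))]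
    [ContinuousSMul (PowerSeries (PowerSeries ℤ_[p])) (BigRepModule (PowerSeries ℤ_[p]) p A₂)]
    (κ : ZpExtension K p) (ρ₂ : ContinuousRep (absoluteGaloisGroup K) (PowerSeries ℤ_[p]) A₂)
    (hD : Greenberg2006.IsCofinitelyGenerated (PowerSeries (PowerSeries ℤ_[p]))
      (BigRepModule (PowerSeries ℤ_[p]) p A₂))
    (hur : ∃ S₀ : Set (HeightOneSpectrum (𝓞 K)), S₀.Finite ∧ GaloisRep.IsUnramifiedOutside S₀ ρ₂)
    (𝔭bar : HeightOneSpectrum (𝓞 K)) (c : PowerSeries (PowerSeries ℤ_[p])) :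
    Module.Finite (PowerSeries (PowerSeries ℤ_[p]))
      (CharacterModule (TorsionControl.selmer (BigGaloisRep.localMap K)
        (BigGaloisRep.strictSet p 𝔭bar (∅ : Set (HeightOneSpectrum (𝓞 K))))
        (TorsionControl.torsionRep (AnticyclotomicBigGaloisRep κ ρ₂) c))) := by
  obtain ⟨S₀, hS₀, h⟩ := hur
  exact module_finite_characterModule_selmer_torsionRep_of_isUnramifiedOutside
    (Classical.choice (nonempty_iwasawaAlgebraTwoVar_ringEquiv_mvPowerSeries p)) κ ρ₂ hD hS₀ h 𝔭bar ∅
    Set.finite_empty c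

end K2TwoVar

/-! ## §4. The finite change of rings `B/(c) → Λ`: glue for the LEAD's scalar tower `Λ → B → Y` -/

section ChangeOfRings

/-- **Finiteness down a scalar tower through a principal quotient.** If `Y` is a finitely generated
`B`-module killed by `b₀`, `Λ → B` is an algebra with `B = Λ·1 + b₀ B`, and `Λ` acts on `Y` compatibly
(`IsScalarTower Λ B Y`), then `Y` is finitely generated over `Λ` (the `B`-generators generate over `Λ`).
[folklore; cite: Greenberg2006, §2 A (p. 345 L1–6, modules over quotients `Λ/I`)] -/
theorem module_finite_of_isScalarTower_of_smul_eq_zero {Λ B Y : Type*} [CommRing Λ] [CommRing B]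
    [Algebra Λ B] [AddCommGroup Y] [Module B Y] [Module Λ Y] [IsScalarTower Λ B Y] [hY : Module.Finite B Y]
    (b₀ : B) (hb₀ : ∀ y : Y, b₀ • y = 0)
    (hdec : ∀ b : B, ∃ (l : Λ) (b' : B), b = algebraMap Λ B l + b₀ * b') : Module.Finite Λ Y := by
  obtain ⟨s, hs⟩ := hY.fg_top
  refine ⟨⟨s, eq_top_iff.2 fun y _ ↦ ?_⟩⟩
  have hy : y ∈ Submodule.span B (s : Set Y) := hs ▸ Submodule.mem_top
  refine Submodule.span_induction (hx := hy) (fun x hx ↦ Submodule.subset_span hx) (zero_mem _)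
    (fun x y _ _ hx hy ↦ add_mem hx hy) (fun b x _ hx ↦ ?_)
  obtain ⟨l, b', rfl⟩ := hdec b
  rw [add_smul, algebraMap_smul, mul_comm, mul_smul, hb₀, smul_zero, add_zero]
  exact Submodule.smul_mem _ l hx

/-- `R⟦X⟧⟦T⟧ = R⟦T⟧·1 + (C X)·R⟦X⟧⟦T⟧` coefficientwise: `b = map C (map constantCoeff b) + C X · b'`
(`b_n(X) = b_n(0) + X·b_n'(X)` for every `T`-coefficient). [folklore] -/
theorem powerSeries_eq_map_C_add_C_X_mul {R : Type*} [CommRing R] (b : PowerSeries (PowerSeries R)) :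
    b = PowerSeries.map (PowerSeries.C (R := R)) (PowerSeries.map (PowerSeries.constantCoeff (R := R)) b) +
      PowerSeries.C (PowerSeries.X : PowerSeries R) *
        PowerSeries.mk fun n ↦ PowerSeries.mk fun m ↦
          PowerSeries.coeff (m + 1) (PowerSeries.coeff n b) := by
  ext n : 1
  simp only [map_add, PowerSeries.coeff_map, PowerSeries.coeff_C_mul, PowerSeries.coeff_mk]
  rw [add_comm]
  exact PowerSeries.eq_X_mul_shift_add_const _

/-- The decomposition `b = algebraMap Λ B l + C X · b'` for the tower `Λ = R⟦T⟧ → B = R⟦X⟧⟦T⟧`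
(`PowerSeries.algebraPowerSeries`, `algebraMap = PowerSeries.map C`). [folklore] -/
theorem exists_eq_algebraMap_add_C_X_mul {R : Type*} [CommRing R] (b : PowerSeries (PowerSeries R)) :
    ∃ (l : PowerSeries R) (b' : PowerSeries (PowerSeries R)),
      b = algebraMap (PowerSeries R) (PowerSeries (PowerSeries R)) l +
        PowerSeries.C (PowerSeries.X : PowerSeries R) * b' := by
  refine ⟨PowerSeries.map PowerSeries.constantCoeff b,
    PowerSeries.mk fun n ↦ PowerSeries.mk fun m ↦ PowerSeries.coeff (m + 1) (PowerSeries.coeff n b), ?_⟩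
  rw [PowerSeries.algebraMap_apply'', show algebraMap R (PowerSeries R) = PowerSeries.C from
    RingHom.ext fun r ↦ (PowerSeries.C_eq_algebraMap (r := r)).symm]
  exact powerSeries_eq_map_C_add_C_X_mul b

/-- **`Module.Finite B Y → Module.Finite Λ Y` for `Λ = R⟦T⟧ → B = R⟦X⟧⟦T⟧` and `Y` killed by `C X`**, for ANY
compatible `Λ`-structure on `Y` (the LEAD's binder shape `∀ [Module Λ Y] [IsScalarTower Λ B Y]`).
[folklore; cite: Greenberg2006, §2 A (p. 345 L1–6)] -/
theorem module_finite_powerSeries_of_twoVar {R : Type*} [CommRing R] {Y : Type*} [AddCommGroup Y]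
    [Module (PowerSeries (PowerSeries R)) Y] [Module.Finite (PowerSeries (PowerSeries R)) Y]
    (hY : ∀ y : Y, PowerSeries.C (PowerSeries.X : PowerSeries R) • y = 0)
    [Module (PowerSeries R) Y] [IsScalarTower (PowerSeries R) (PowerSeries (PowerSeries R)) Y] :
    Module.Finite (PowerSeries R) Y :=
  module_finite_of_isScalarTower_of_smul_eq_zero (PowerSeries.C (PowerSeries.X : PowerSeries R)) hY
    exists_eq_algebraMap_add_C_X_mul

end ChangeOfRings

/-! ## §5. `c` kills the dual Selmer module of the torsion subrepresentation `M[c]` -/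

section Killed

variable {Λ : Type*} [CommRing Λ] [TopologicalSpace Λ]
  {Γ : Type u} [Group Γ] [TopologicalSpace Γ] [IsTopologicalGroup Γ]
  {M : Type u} [AddCommGroup M] [Module Λ M] [TopologicalSpace M] [DiscreteTopology M] [ContinuousSMul Λ M]
  {ι : Type*} {Γv : ι → Type u} [∀ v, Group (Γv v)] [∀ v, TopologicalSpace (Γv v)]
  [∀ v, IsTopologicalGroup (Γv v)] (φ : ∀ v, Γv v →ₜ* Γ) (L : Set ι)

/-- `c` kills `H¹(Γ, M[c])` (the module structure of cohomology comes from the coefficients).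
[cite: Greenberg2006, §3 A (p. 358 L7–8)] -/
theorem smul_continuousCohomology_torsionRep_eq_zero (ρ : ContinuousRep Γ Λ M) (c : Λ) (n : ℕ)
    (x : continuousCohomology n (TorsionControl.torsionRep ρ c).toTopRep) : c • x = 0 :=
  ContinuousRep.smul_continuousCohomology_eq_zero _ c
    (fun d ↦ Subtype.ext (by rw [Submodule.coe_smul, Submodule.coe_zero]; exact d.2)) n x

/-- `c` kills `Sel(M[c])^∨ = CharacterModule (Sel_L(Γ, M[c]))`. [cite: Greenberg2006, §3 A (p. 358 L7–8)] -/
theorem smul_characterModule_selmer_torsionRep_eq_zero (ρ : ContinuousRep Γ Λ M) (c : Λ)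
    (y : CharacterModule (TorsionControl.selmer φ L (TorsionControl.torsionRep ρ c))) : c • y = 0 := by
  ext s
  have hs : c • s = 0 := Subtype.ext (by
    rw [Submodule.coe_smul, Submodule.coe_zero]
    exact smul_continuousCohomology_torsionRep_eq_zero ρ c 1 _)
  rw [CharacterModule.smul_apply, hs, map_zero]
  rfl

end Killed

end Summit.BirchSwinnertonDyer.BirchSwinnertonDyer.Theorems.TelescopeK2TorsionSelmerCofinite
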